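import Summits.MatrixMultiplication.OmegaCensus.ThreeSetZ5Z5Cover44
import Summits.MatrixMultiplication.OmegaCensus.ThreeSetZ5Z5Cells36
import HarnessLib

/-!
# No cube law triple with two parts `4` over `A ↠ ℤ₅ × ℤ₅` of order `625` (the census cell `(4,4,13)@625`, all four groups)

ω-census `pub-omega`, family (b3), seat pub-omega-group gen 36.  Framing: lottery ticket; floor = certified bounds/negative
ranges.  VALUE: a kernel theorem about the group-theoretic method (TPP capacity of dihedral-like groups); NOT progress on ω.
Census: the cell `(4,4,13)` at `|A| = 625` — `A ∈ {ℤ₅×ℤ₁₂₅, ℤ₂₅², ℤ₅²×ℤ₂₅, ℤ₅⁴}` (every abelian group of order `625` other than `ℤ₆₂₅`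
maps onto `ℤ₅²`) — hitherto ENGINE ×3 (NR112 / Pb37 / dom3set), is KERNEL.

**Theorem (`no_cube_form_44_of_onto_z5z5_card625`).**  Let `|A| = 625`, `Φ : A ↠ ZMod 5 × ZMod 5`, and let `(W, X, Y, x₀)` be a
three-set cube SYMMETRIC form over `A` with `|W| = |X| = 4`.  Then `False`.
*Proof.*  `W = {w₀, w₁, w₂, w₃}`; translate by `−w₀`.  If the three images `Φ(wᵢ − w₀)` were pairwise dependent, `W − w₀` would lie
in the proper subgroup `ker(λ∘Φ)` for a non-zero form `λ` (`exists_form_of_dets_eq_zero`, decided), contradicting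
`card_eq_one_of_subset_coset`; so (up to the order of `w₁, w₂, w₃`) a basis change gives `Φ'(W − w₀) = {0, e₁, e₂, c}` with
`c = pt 5 ci`.  The kernel cover `exists_cert44` gives, for the image multiset of `X − w₀` and the hole `Φ'(x₀ − w₀)`, a direction
`j` whose three-set line datum carries either a modular Farkas certificate (`lineCert3At_sound`) or — for the four 'centroid' frames,
whose `ℤ₅²` data are consistent from `|A| = 3025` on — an LP certificate at line fibre size `125 = 625/5` (`false_of_farkasOK5`);
either contradicts the three-set line identity along `lineDir j ∘ Φ'`.  ∎
* TPP statements: `no_law_cube_44e_of_onto_z5z5_card625`, the all-orderings cell form `no_law_cube_four_four_of_onto_z5z5_card625`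
  (dihedral-like `G` over `A`, `|A| = 625`, any `c₀`; every element of `A` is a double since `625` is odd), and the instances
  `no_law_cube_four_four_z5_z125`, `…_z25_z25`, `…_z5_z5_z25`, `…_z5_pow4` (all four groups of order `625` of the cell).
-/

namespace Summit.MatrixMultiplication.OmegaCensus

open Finset ZpZpDomino Z5Z5ThreeSet

/-! ## Finite facts about `ℤ₅²` -/

/-- The line images of `W = T ∪ {pt 5 ci}`: `vecFn (wvec44 ci j)` adds the indicator of `lineDir j (pt 5 ci)` to `vecFn (wvec j)`.
[folklore] -/
theorem Z5Z5ThreeSet.vecFn_wvec44 (ci j : ℕ) (t : ZMod 5) :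
    vecFn (wvec44 ci j) t = vecFn (wvec j) t + (if lineDir 5 j (pt 5 ci) = t then 1 else 0) := by
  show (wvec44 ci j).getD t.val 0 = (wvec j).getD t.val 0 + _
  rw [wvec44, Literature.Computability.Complexity.getD_ofFn _ _ (ZMod.val_lt t)]
  congr 1
  have key : lineDir 5 j (pt 5 ci) = t ↔ pv 5 j ci = t.val := by
    rw [← lineDir_pt_eq_iff 5 j ci (ZMod.val_lt t), ZMod.natCast_zmod_val]
  by_cases h : pv 5 j ci = t.val
  · rw [if_pos h, if_pos (key.2 h)]
  · rw [if_neg h, if_neg (fun e => h (key.1 e))]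

/-- Three pairwise dependent vectors of `ℤ₅²` are killed by a common non-zero linear form. [folklore] -/
theorem Z5Z5ThreeSet.exists_form_of_dets_eq_zero : ∀ u v w : ZMod 5 × ZMod 5,
    u.1 * v.2 - u.2 * v.1 = 0 → u.1 * w.2 - u.2 * w.1 = 0 → v.1 * w.2 - v.2 * w.1 = 0 →
    ∃ ab : ZMod 5 × ZMod 5, ab ≠ 0 ∧ ab.1 * u.1 + ab.2 * u.2 = 0 ∧ ab.1 * v.1 + ab.2 * v.2 = 0 ∧ ab.1 * w.1 + ab.2 * w.2 = 0 := by
  decide +kernel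

section Core

variable {A : Type*} [AddCommGroup A] [Fintype A] [DecidableEq A]

/-- All fibres of a surjection onto `ZMod 5` have size `|A| / 5`: `5 · |φ⁻¹(0)| = |A|`. [folklore] -/
theorem five_mul_card_fibre (φ : A →+ ZMod 5) (hφ : Function.Surjective φ) :
    5 * (univ.filter fun a : A => φ a = 0).card = Fintype.card A := by
  classical
  rw [← Finset.card_univ (α := A), Finset.card_eq_sum_card_fiberwise (f := fun a : A => φ a) (s := univ) (t := univ)
    (fun a _ => mem_coe.2 (mem_univ _))]
  rw [Finset.sum_congr rfl fun t _ => card_fibre_eq_of_surjective φ hφ t 0, sum_const, card_univ, ZMod.card, smul_eq_mul]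

/-- **Core step** (frame already ordered): translated symmetric form `(W', X', Y', x₀')` with `W' = {0, a, b, c}` (distinct,
non-zero), `det(Φ a, Φ b) ≠ 0`, `|X'| = 4`, `|A| = 625`.  Then `False`. [folklore] -/
theorem no_cube_form_44_core (hA : Fintype.card A = 625) (Φ : A →+ ZMod 5 × ZMod 5) (hΦ : Function.Surjective Φ)
    {W' X' Y' : Finset A} {x₀' a b c : A} (hWt : W' = {0, a, b, c}) (ha0 : a ≠ 0) (hb0 : b ≠ 0) (hc0 : c ≠ 0)
    (hab : a ≠ b) (hac : a ≠ c) (hbc : b ≠ c) (hD : (Φ a).1 * (Φ b).2 - (Φ a).2 * (Φ b).1 ≠ 0) (hX : X'.card = 4)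
    (t₁ : Set.InjOn (fun p : A × A × A => -p.1 + p.2.1 + p.2.2) ↑(W' ×ˢ X' ×ˢ Y'))
    (t₂ : Set.InjOn (fun p : A × A × A => p.1 - p.2.1 + p.2.2) ↑(W' ×ˢ X' ×ˢ Y'))
    (t₃ : Set.InjOn (fun p : A × A × A => p.1 + p.2.1 - p.2.2) ↑(W' ×ˢ X' ×ˢ Y'))
    (e₁₂ : Disjoint ((W' ×ˢ X' ×ˢ Y').image fun p : A × A × A => -p.1 + p.2.1 + p.2.2)
      ((W' ×ˢ X' ×ˢ Y').image fun p : A × A × A => p.1 - p.2.1 + p.2.2))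
    (e₁₃ : Disjoint ((W' ×ˢ X' ×ˢ Y').image fun p : A × A × A => -p.1 + p.2.1 + p.2.2)
      ((W' ×ˢ X' ×ˢ Y').image fun p : A × A × A => p.1 + p.2.1 - p.2.2))
    (e₂₃ : Disjoint ((W' ×ˢ X' ×ˢ Y').image fun p : A × A × A => p.1 - p.2.1 + p.2.2)
      ((W' ×ˢ X' ×ˢ Y').image fun p : A × A × A => p.1 + p.2.1 - p.2.2))
    (tcov : ((W' ×ˢ X' ×ˢ Y').image fun p : A × A × A => -p.1 + p.2.1 + p.2.2) ∪
      ((W' ×ˢ X' ×ˢ Y').image fun p : A × A × A => p.1 - p.2.1 + p.2.2) ∪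
      ((W' ×ˢ X' ×ˢ Y').image fun p : A × A × A => p.1 + p.2.1 - p.2.2) = univ.erase x₀') : False := by
  classical
  haveI : Fact (Nat.Prime 5) := ⟨by norm_num⟩
  set E := basisEquiv (Φ a) (Φ b) hD with hE
  set Φ' : A →+ ZMod 5 × ZMod 5 := E.symm.toAddMonoidHom.comp Φ with hΦ'
  have hΦ's : Function.Surjective Φ' := E.symm.surjective.comp hΦ
  have hΦ'a : Φ' a = (1, 0) := by
    show E.symm (Φ a) = _
    rw [AddEquiv.symm_apply_eq]; exact (basisEquiv_one_zero _ _ hD).symm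
  have hΦ'b : Φ' b = (0, 1) := by
    show E.symm (Φ b) = _
    rw [AddEquiv.symm_apply_eq]; exact (basisEquiv_zero_one _ _ hD).symm
  -- the fourth point, the hole and the image multiset of `X'`
  set ci : ℕ := ptIdx 5 (Φ' c) with hcidef
  have hci : ci < 25 := ptIdx_lt 5 _
  have hc' : Φ' c = pt 5 ci := by rw [hcidef, pt_ptIdx]
  set s : ZMod 5 × ZMod 5 := Φ' x₀' with hs
  set σ : ℕ := ptIdx 5 s with hσdef
  have hσ : σ < 25 := ptIdx_lt 5 s
  set g : Fin (5 * 5) → ℕ := fun i => (X'.filter fun x => Φ' x = pt 5 i.val).card with hg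
  have hgsum : ∑ i, g i = 4 := by
    have h0 := ZpZpDomino.sum_card_fibre_shift Φ' X' 0
    rw [sum_eq_sum_pt 5] at h0
    simp only [add_zero] at h0
    rw [hX] at h0
    exact h0
  obtain ⟨j, hj, hcert⟩ := exists_cert44 ci hci σ hσ g hgsum
  -- the line identity in direction `j`
  set π : ZMod 5 × ZMod 5 →+ ZMod 5 := lineDir 5 j with hπ
  set φ : A →+ ZMod 5 := π.comp Φ' with hφ
  have hφs : Function.Surjective φ := (lineDir_surjective 5 j).comp hΦ's
  have eφ : ∀ x, φ x = π (Φ' x) := fun x => rfl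
  have hWc : ∀ t : ZMod 5, (W'.filter fun x => φ x = t).card = vecFn (wvec44 ci j) t := by
    intro t
    rw [vecFn_wvec44, vecFn_wvec j hj t, hWt, card_filter, sum_insert (by simp [ha0.symm, hb0.symm, hc0.symm]),
      sum_insert (by simp [hab, hac]), sum_insert (by simpa using hbc), sum_singleton, map_zero, eφ a, eφ b, eφ c, hΦ'a,
      hΦ'b, hc']
    ring
  have hXc : ∀ t : ZMod 5, (X'.filter fun x => φ x = t).card = vecFn (cnts 5 j g) t := by
    intro t
    show _ = (cnts 5 j g).getD t.val 0
    rw [getD_cnts j g (ZMod.val_lt t), ← sum_filter_eq_sum_pick 5 j (fun w => (X'.filter fun x => Φ' x = w).card)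
      (ZMod.val_lt t), ZMod.natCast_zmod_val, ← card_fibre_comp_eq_sum Φ' π X' t]
    simp only [eφ]
  have hhole : φ x₀' = ((pv 5 j σ : ℕ) : ZMod 5) := by
    rw [eφ, ← hs, ← pt_ptIdx 5 s, ← hσdef, ← lineDir_pt_val 5 j σ, ZMod.natCast_zmod_val]
  have hK : (univ.filter fun x : A => φ x = 0).card = 125 := by
    have h5 := five_mul_card_fibre φ hφs
    rw [hA] at h5
    omega
  have hid : ∀ t : ZMod 5, (∑ u : ZMod 5, lineMat3 (vecFn (wvec44 ci j)) (vecFn (cnts 5 j g)) t u *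
      (Y'.filter fun x => φ x = u).card) + (if ((pv 5 j σ : ℕ) : ZMod 5) = t then 1 else 0) = 125 := by
    refine lineMat3_identity_of_double_sum fun t => ?_
    have h0 := ThreeSetNorm.three_set_line_identity φ hφs t₁ t₂ t₃ e₁₂ e₁₃ e₂₃ tcov t
    simp only [hWc, hXc, hhole, hK] at h0
    exact h0
  rcases hcert with ⟨certs, hc⟩ | ⟨z, hz⟩
  · exact lineCert3At_sound hc _ _ hid
  · exact false_of_farkasOK5 (pv_lt 5 j σ) hz _ hid

/-- **No three-set cube symmetric form with `|W| = |X| = 4` over `A ↠ ℤ₅ × ℤ₅` of order `625`.** [folklore] -/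
theorem no_cube_form_44_of_onto_z5z5_card625 (hA : Fintype.card A = 625) (Φ : A →+ ZMod 5 × ZMod 5)
    (hΦ : Function.Surjective Φ) {W X Y : Finset A} {x₀ : A} (hW : W.card = 4) (hX : X.card = 4)
    (h₁ : Set.InjOn (fun p : A × A × A => -p.1 + p.2.1 + p.2.2) ↑(W ×ˢ X ×ˢ Y))
    (h₂ : Set.InjOn (fun p : A × A × A => p.1 - p.2.1 + p.2.2) ↑(W ×ˢ X ×ˢ Y))
    (h₃ : Set.InjOn (fun p : A × A × A => p.1 + p.2.1 - p.2.2) ↑(W ×ˢ X ×ˢ Y))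
    (d₁₂ : Disjoint ((W ×ˢ X ×ˢ Y).image fun p : A × A × A => -p.1 + p.2.1 + p.2.2)
      ((W ×ˢ X ×ˢ Y).image fun p : A × A × A => p.1 - p.2.1 + p.2.2))
    (d₁₃ : Disjoint ((W ×ˢ X ×ˢ Y).image fun p : A × A × A => -p.1 + p.2.1 + p.2.2)
      ((W ×ˢ X ×ˢ Y).image fun p : A × A × A => p.1 + p.2.1 - p.2.2))
    (d₂₃ : Disjoint ((W ×ˢ X ×ˢ Y).image fun p : A × A × A => p.1 - p.2.1 + p.2.2)
      ((W ×ˢ X ×ˢ Y).image fun p : A × A × A => p.1 + p.2.1 - p.2.2))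
    (hcover : ((W ×ˢ X ×ˢ Y).image fun p : A × A × A => -p.1 + p.2.1 + p.2.2) ∪
      ((W ×ˢ X ×ˢ Y).image fun p : A × A × A => p.1 - p.2.1 + p.2.2) ∪
      ((W ×ˢ X ×ˢ Y).image fun p : A × A × A => p.1 + p.2.1 - p.2.2) = univ.erase x₀) : False := by
  classical
  -- four distinct points `w₀, w₁, w₂, w₃`
  have hWne : W.Nonempty := by rw [← card_pos, hW]; norm_num
  obtain ⟨w₀, hw₀⟩ := hWne
  have hW3 : (W.erase w₀).card = 3 := by rw [card_erase_of_mem hw₀, hW]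
  obtain ⟨w₁, w₂, w₃, h12, h13, h23, hWe⟩ := card_eq_three.1 hW3
  have hm : ∀ x, x ∈ W.erase w₀ ↔ x = w₁ ∨ x = w₂ ∨ x = w₃ := fun x => by rw [hWe]; simp
  have h01 : w₀ ≠ w₁ := fun e => by have := (hm w₁).2 (Or.inl rfl); rw [← e] at this; simp at this
  have h02 : w₀ ≠ w₂ := fun e => by have := (hm w₂).2 (Or.inr (Or.inl rfl)); rw [← e] at this; simp at this
  have h03 : w₀ ≠ w₃ := fun e => by have := (hm w₃).2 (Or.inr (Or.inr rfl)); rw [← e] at this; simp at this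
  have hWeq : W = {w₀, w₁, w₂, w₃} := by rw [← insert_erase hw₀, hWe]
  -- translate by `−w₀`
  obtain ⟨t₁, t₂, t₃, e₁₂, e₁₃, e₂₃, tcov, cW, cX, -⟩ :=
    cube_symmetric_form_translate h₁ h₂ h₃ d₁₂ d₁₃ d₂₃ hcover (-w₀)
  set W' := W.image (· + -w₀) with hW'
  set X' := X.image (· + -w₀) with hX'
  set u₁ := w₁ - w₀ with hu₁
  set u₂ := w₂ - w₀ with hu₂
  set u₃ := w₃ - w₀ with hu₃
  have hWt : W' = {0, u₁, u₂, u₃} := by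
    rw [hW', hWeq, image_insert, image_insert, image_insert, image_singleton, add_neg_cancel, hu₁, hu₂, hu₃,
      sub_eq_add_neg, sub_eq_add_neg, sub_eq_add_neg]
  have h10 : u₁ ≠ 0 := sub_ne_zero.2 (Ne.symm h01)
  have h20 : u₂ ≠ 0 := sub_ne_zero.2 (Ne.symm h02)
  have h30 : u₃ ≠ 0 := sub_ne_zero.2 (Ne.symm h03)
  have h12' : u₁ ≠ u₂ := fun e => h12 (sub_left_injective e)
  have h13' : u₁ ≠ u₃ := fun e => h13 (sub_left_injective e)
  have h23' : u₂ ≠ u₃ := fun e => h23 (sub_left_injective e)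
  have hXc : X'.card = 4 := by rw [cX, hX]
  by_cases hD12 : (Φ u₁).1 * (Φ u₂).2 - (Φ u₁).2 * (Φ u₂).1 = 0
  · by_cases hD13 : (Φ u₁).1 * (Φ u₃).2 - (Φ u₁).2 * (Φ u₃).1 = 0
    · by_cases hD23 : (Φ u₂).1 * (Φ u₃).2 - (Φ u₂).2 * (Φ u₃).1 = 0
      · -- all images on one line through `0`: `W'` in a proper subgroup
        obtain ⟨ab, hab, hau, hav, haw⟩ := exists_form_of_dets_eq_zero (Φ u₁) (Φ u₂) (Φ u₃) hD12 hD13 hD23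
        set ψ : A →+ ZMod 5 := (lmap ab.1 ab.2).comp Φ with hψ
        have hψs : Function.Surjective ψ := (lmap_surjective ab hab).comp hΦ
        have hH : ψ.ker ≠ ⊤ := by
          intro htop
          obtain ⟨x, hx⟩ := hψs 1
          have hmem : x ∈ ψ.ker := by rw [htop]; exact AddSubgroup.mem_top x
          rw [AddMonoidHom.mem_ker] at hmem
          exact absurd (hx.symm.trans hmem) (by decide)
        have hcard := card_eq_one_of_subset_coset t₁ t₂ t₃ e₁₂ e₁₃ e₂₃ tcov ψ.ker hH 0 (fun w hw => by
          rw [sub_zero, AddMonoidHom.mem_ker]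
          rw [hWt] at hw
          simp only [mem_insert, mem_singleton] at hw
          rcases hw with rfl | rfl | rfl | rfl
          · exact map_zero ψ
          · show lmap ab.1 ab.2 (Φ u₁) = 0
            rw [lmap_apply]; exact hau
          · show lmap ab.1 ab.2 (Φ u₂) = 0
            rw [lmap_apply]; exact hav
          · show lmap ab.1 ab.2 (Φ u₃) = 0
            rw [lmap_apply]; exact haw)
        rw [cW, hW] at hcard
        omega
      · -- frame `(u₂, u₃)`, fourth point `u₁`
        have hWt' : W' = {0, u₂, u₃, u₁} := by
          rw [hWt]; ext x; simp only [mem_insert, mem_singleton]; tauto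
        exact no_cube_form_44_core hA Φ hΦ hWt' h20 h30 h10 h23' h12'.symm h13'.symm hD23 hXc t₁ t₂ t₃ e₁₂ e₁₃ e₂₃ tcov
    · -- frame `(u₁, u₃)`, fourth point `u₂`
      have hWt' : W' = {0, u₁, u₃, u₂} := by
        rw [hWt]; ext x; simp only [mem_insert, mem_singleton]; tauto
      exact no_cube_form_44_core hA Φ hΦ hWt' h10 h30 h20 h13' h12' h23'.symm hD13 hXc t₁ t₂ t₃ e₁₂ e₁₃ e₂₃ tcov
  · exact no_cube_form_44_core hA Φ hΦ hWt h10 h20 h30 h12' h13' h23' hD12 hXc t₁ t₂ t₃ e₁₂ e₁₃ e₂₃ tcov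

end Core

/-! ## The TPP statements -/

section DihedralLike

variable {A : Type} [AddCommGroup A] [DecidableEq A] [Fintype A] {G : Type} [Group G] [DecidableEq G]
  {ρ τ : A → G} {c₀ : A} {S T U : Finset G}

open Literature.Combinatorics.Additive

/-- **No `(4,4 | 4,4 | e,e)` law triple over `A ↠ ℤ₅ × ℤ₅` of order `625`** (dihedral-like `G`, any `c₀`). [folklore] -/
theorem no_law_cube_44e_of_onto_z5z5_card625 (hA : Fintype.card A = 625)
    (hρρ : ∀ a b, ρ a * ρ b = ρ (a + b)) (hρτ : ∀ a b, ρ a * τ b = τ (b - a))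
    (hτρ : ∀ a b, τ a * ρ b = τ (a + b)) (hττ : ∀ a b, τ a * τ b = ρ (c₀ + b - a))
    (hρ : Function.Injective ρ) (hτ : Function.Injective τ) (hne : ∀ a b, ρ a ≠ τ b)
    (hsurj : ∀ g, (∃ a, ρ a = g) ∨ (∃ a, τ a = g))
    (Φ : A →+ ZMod 5 × ZMod 5) (hΦ : Function.Surjective Φ)
    (h : TripleProductProperty S T U)
    (hS₀ : (univ.filter fun a : A => ρ a ∈ S).card = 4) (hS₁ : (univ.filter fun a : A => τ a ∈ S).card = 4)
    (hT₀ : (univ.filter fun a : A => ρ a ∈ T).card = 4) (hT₁ : (univ.filter fun a : A => τ a ∈ T).card = 4)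
    (hU : (univ.filter fun a : A => ρ a ∈ U).card = (univ.filter fun a : A => τ a ∈ U).card)
    (hV : 3 * (S.card * T.card * U.card) + 8 = 8 * Fintype.card A) : False := by
  classical
  have hhalf : ∀ c : A, ∃ a : A, a + a = c := exists_add_self_eq_of_card_odd (by rw [hA]; decide)
  obtain ⟨W, X, Y, x₀, hWc, hXc, -, i₁, i₂, i₃, d₁₂, d₁₃, d₂₃, hcover⟩ :=
    cube_symmetric_form_of_law hρρ hρτ hτρ hττ hρ hτ hne hsurj hhalf h (by rw [hS₀, hS₁]) (by rw [hT₀, hT₁]) hU hV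
  rw [hS₀] at hWc
  rw [hT₀] at hXc
  exact no_cube_form_44_of_onto_z5z5_card625 hA Φ hΦ hWc hXc i₁ i₂ i₃ d₁₂ d₁₃ d₂₃ hcover

/-- **Cell form `(4,4,·)@625`**: balanced coset parts with two parts `4` in any two of `S, T, U` ⇒ `3|S||T||U| + 8 ≠ 8|A|` over
`A ↠ ℤ₅ × ℤ₅` of order `625`. [folklore] -/
theorem no_law_cube_four_four_of_onto_z5z5_card625 (hA : Fintype.card A = 625)
    (hρρ : ∀ a b, ρ a * ρ b = ρ (a + b)) (hρτ : ∀ a b, ρ a * τ b = τ (b - a))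
    (hτρ : ∀ a b, τ a * ρ b = τ (a + b)) (hττ : ∀ a b, τ a * τ b = ρ (c₀ + b - a))
    (hρ : Function.Injective ρ) (hτ : Function.Injective τ) (hne : ∀ a b, ρ a ≠ τ b)
    (hsurj : ∀ g, (∃ a, ρ a = g) ∨ (∃ a, τ a = g))
    (Φ : A →+ ZMod 5 × ZMod 5) (hΦ : Function.Surjective Φ)
    (h : TripleProductProperty S T U)
    (hS : (univ.filter fun a : A => ρ a ∈ S).card = (univ.filter fun a : A => τ a ∈ S).card)
    (hT : (univ.filter fun a : A => ρ a ∈ T).card = (univ.filter fun a : A => τ a ∈ T).card)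
    (hU : (univ.filter fun a : A => ρ a ∈ U).card = (univ.filter fun a : A => τ a ∈ U).card)
    (h44 : ((univ.filter fun a : A => ρ a ∈ S).card = 4 ∧ (univ.filter fun a : A => ρ a ∈ T).card = 4) ∨
      ((univ.filter fun a : A => ρ a ∈ T).card = 4 ∧ (univ.filter fun a : A => ρ a ∈ U).card = 4) ∨
      ((univ.filter fun a : A => ρ a ∈ U).card = 4 ∧ (univ.filter fun a : A => ρ a ∈ S).card = 4) ∨
      ((univ.filter fun a : A => ρ a ∈ S).card = 4 ∧ (univ.filter fun a : A => ρ a ∈ T).card = 4) ∨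
      ((univ.filter fun a : A => ρ a ∈ T).card = 4 ∧ (univ.filter fun a : A => ρ a ∈ U).card = 4) ∨
      ((univ.filter fun a : A => ρ a ∈ U).card = 4 ∧ (univ.filter fun a : A => ρ a ∈ S).card = 4)) :
    3 * (S.card * T.card * U.card) + 8 ≠ 8 * Fintype.card A :=
  no_law_cube_two_parts_of_ordered 4 4
    (fun h' hS₀ hS₁ hT₀ hT₁ hU' hV => no_law_cube_44e_of_onto_z5z5_card625 hA hρρ hρτ hτρ hττ hρ hτ hne hsurj Φ hΦ h'
      hS₀ hS₁ hT₀ hT₁ hU' hV) h hS hT hU h44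

/-- The projection `ℤ₅ × ℤ₁₂₅ ↠ ℤ₅ × ℤ₅`. [folklore] -/
def Z5Z5ThreeSet.projZ5Z125 : ZMod 5 × ZMod 125 →+ ZMod 5 × ZMod 5 :=
  (AddMonoidHom.id (ZMod 5)).prodMap (ZMod.castHom (show 5 ∣ 125 by norm_num) (ZMod 5)).toAddMonoidHom

/-- `projZ5Z125` is onto. [folklore] -/
theorem Z5Z5ThreeSet.projZ5Z125_surjective : Function.Surjective projZ5Z125 := by
  intro x
  refine ⟨(x.1, ((x.2.val : ℕ) : ZMod 125)), ?_⟩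
  ext
  · rfl
  · show ZMod.castHom (show 5 ∣ 125 by norm_num) (ZMod 5) ((x.2.val : ℕ) : ZMod 125) = x.2
    rw [map_natCast, ZMod.natCast_zmod_val]

/-- The projection `ℤ₂₅ × ℤ₂₅ ↠ ℤ₅ × ℤ₅`. [folklore] -/
def Z5Z5ThreeSet.projZ25Z25 : ZMod 25 × ZMod 25 →+ ZMod 5 × ZMod 5 :=
  (ZMod.castHom (show 5 ∣ 25 by norm_num) (ZMod 5)).toAddMonoidHom.prodMap
    (ZMod.castHom (show 5 ∣ 25 by norm_num) (ZMod 5)).toAddMonoidHom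

/-- `projZ25Z25` is onto. [folklore] -/
theorem Z5Z5ThreeSet.projZ25Z25_surjective : Function.Surjective projZ25Z25 := by
  intro x
  refine ⟨(((x.1.val : ℕ) : ZMod 25), ((x.2.val : ℕ) : ZMod 25)), ?_⟩
  ext
  · show ZMod.castHom (show 5 ∣ 25 by norm_num) (ZMod 5) ((x.1.val : ℕ) : ZMod 25) = x.1
    rw [map_natCast, ZMod.natCast_zmod_val]
  · show ZMod.castHom (show 5 ∣ 25 by norm_num) (ZMod 5) ((x.2.val : ℕ) : ZMod 25) = x.2
    rw [map_natCast, ZMod.natCast_zmod_val]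

/-- **Census instance `(4,4,13)@625` for `A = ℤ₅ × ℤ₁₂₅`** (any `c₀`). [folklore] -/
theorem no_law_cube_four_four_z5_z125 {ρ τ : ZMod 5 × ZMod 125 → G} {c₀ : ZMod 5 × ZMod 125}
    (hρρ : ∀ a b, ρ a * ρ b = ρ (a + b)) (hρτ : ∀ a b, ρ a * τ b = τ (b - a))
    (hτρ : ∀ a b, τ a * ρ b = τ (a + b)) (hττ : ∀ a b, τ a * τ b = ρ (c₀ + b - a))
    (hρ : Function.Injective ρ) (hτ : Function.Injective τ) (hne : ∀ a b, ρ a ≠ τ b)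
    (hsurj : ∀ g, (∃ a, ρ a = g) ∨ (∃ a, τ a = g))
    (h : TripleProductProperty S T U)
    (hS : (univ.filter fun a => ρ a ∈ S).card = (univ.filter fun a => τ a ∈ S).card)
    (hT : (univ.filter fun a => ρ a ∈ T).card = (univ.filter fun a => τ a ∈ T).card)
    (hU : (univ.filter fun a => ρ a ∈ U).card = (univ.filter fun a => τ a ∈ U).card)
    (h44 : ((univ.filter fun a => ρ a ∈ S).card = 4 ∧ (univ.filter fun a => ρ a ∈ T).card = 4) ∨
      ((univ.filter fun a => ρ a ∈ T).card = 4 ∧ (univ.filter fun a => ρ a ∈ U).card = 4) ∨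
      ((univ.filter fun a => ρ a ∈ U).card = 4 ∧ (univ.filter fun a => ρ a ∈ S).card = 4) ∨
      ((univ.filter fun a => ρ a ∈ S).card = 4 ∧ (univ.filter fun a => ρ a ∈ T).card = 4) ∨
      ((univ.filter fun a => ρ a ∈ T).card = 4 ∧ (univ.filter fun a => ρ a ∈ U).card = 4) ∨
      ((univ.filter fun a => ρ a ∈ U).card = 4 ∧ (univ.filter fun a => ρ a ∈ S).card = 4)) :
    3 * (S.card * T.card * U.card) + 8 ≠ 8 * Fintype.card (ZMod 5 × ZMod 125) :=
  no_law_cube_four_four_of_onto_z5z5_card625 (by rw [Fintype.card_prod, ZMod.card, ZMod.card]) hρρ hρτ hτρ hττ hρ hτ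
    hne hsurj projZ5Z125 projZ5Z125_surjective h hS hT hU h44

/-- **Census instance `(4,4,13)@625` for `A = ℤ₂₅ × ℤ₂₅`** (any `c₀`). [folklore] -/
theorem no_law_cube_four_four_z25_z25 {ρ τ : ZMod 25 × ZMod 25 → G} {c₀ : ZMod 25 × ZMod 25}
    (hρρ : ∀ a b, ρ a * ρ b = ρ (a + b)) (hρτ : ∀ a b, ρ a * τ b = τ (b - a))
    (hτρ : ∀ a b, τ a * ρ b = τ (a + b)) (hττ : ∀ a b, τ a * τ b = ρ (c₀ + b - a))
    (hρ : Function.Injective ρ) (hτ : Function.Injective τ) (hne : ∀ a b, ρ a ≠ τ b)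
    (hsurj : ∀ g, (∃ a, ρ a = g) ∨ (∃ a, τ a = g))
    (h : TripleProductProperty S T U)
    (hS : (univ.filter fun a => ρ a ∈ S).card = (univ.filter fun a => τ a ∈ S).card)
    (hT : (univ.filter fun a => ρ a ∈ T).card = (univ.filter fun a => τ a ∈ T).card)
    (hU : (univ.filter fun a => ρ a ∈ U).card = (univ.filter fun a => τ a ∈ U).card)
    (h44 : ((univ.filter fun a => ρ a ∈ S).card = 4 ∧ (univ.filter fun a => ρ a ∈ T).card = 4) ∨
      ((univ.filter fun a => ρ a ∈ T).card = 4 ∧ (univ.filter fun a => ρ a ∈ U).card = 4) ∨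
      ((univ.filter fun a => ρ a ∈ U).card = 4 ∧ (univ.filter fun a => ρ a ∈ S).card = 4) ∨
      ((univ.filter fun a => ρ a ∈ S).card = 4 ∧ (univ.filter fun a => ρ a ∈ T).card = 4) ∨
      ((univ.filter fun a => ρ a ∈ T).card = 4 ∧ (univ.filter fun a => ρ a ∈ U).card = 4) ∨
      ((univ.filter fun a => ρ a ∈ U).card = 4 ∧ (univ.filter fun a => ρ a ∈ S).card = 4)) :
    3 * (S.card * T.card * U.card) + 8 ≠ 8 * Fintype.card (ZMod 25 × ZMod 25) :=
  no_law_cube_four_four_of_onto_z5z5_card625 (by rw [Fintype.card_prod, ZMod.card]) hρρ hρτ hτρ hττ hρ hτ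
    hne hsurj projZ25Z25 projZ25Z25_surjective h hS hT hU h44

/-- The projection `ℤ₅ × ℤ₅ × ℤ₂₅ ↠ ℤ₅ × ℤ₅` onto the first two coordinates. [folklore] -/
def Z5Z5ThreeSet.projZ5Z5Z25 : ZMod 5 × ZMod 5 × ZMod 25 →+ ZMod 5 × ZMod 5 :=
  (AddMonoidHom.id (ZMod 5)).prodMap (AddMonoidHom.fst (ZMod 5) (ZMod 25))

/-- `projZ5Z5Z25` is onto. [folklore] -/
theorem Z5Z5ThreeSet.projZ5Z5Z25_surjective : Function.Surjective projZ5Z5Z25 := fun x => ⟨(x.1, (x.2, 0)), rfl⟩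

/-- The projection `ℤ₅⁴ ↠ ℤ₅ × ℤ₅` onto the first two coordinates. [folklore] -/
def Z5Z5ThreeSet.projZ5Pow4 : ZMod 5 × ZMod 5 × ZMod 5 × ZMod 5 →+ ZMod 5 × ZMod 5 :=
  (AddMonoidHom.id (ZMod 5)).prodMap (AddMonoidHom.fst (ZMod 5) (ZMod 5 × ZMod 5))

/-- `projZ5Pow4` is onto. [folklore] -/
theorem Z5Z5ThreeSet.projZ5Pow4_surjective : Function.Surjective projZ5Pow4 := fun x => ⟨(x.1, (x.2, (0, 0))), rfl⟩

/-- **Census instance `(4,4,13)@625` for `A = ℤ₅ × ℤ₅ × ℤ₂₅`** (any `c₀`). [folklore] -/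
theorem no_law_cube_four_four_z5_z5_z25 {ρ τ : ZMod 5 × ZMod 5 × ZMod 25 → G} {c₀ : ZMod 5 × ZMod 5 × ZMod 25}
    (hρρ : ∀ a b, ρ a * ρ b = ρ (a + b)) (hρτ : ∀ a b, ρ a * τ b = τ (b - a))
    (hτρ : ∀ a b, τ a * ρ b = τ (a + b)) (hττ : ∀ a b, τ a * τ b = ρ (c₀ + b - a))
    (hρ : Function.Injective ρ) (hτ : Function.Injective τ) (hne : ∀ a b, ρ a ≠ τ b)
    (hsurj : ∀ g, (∃ a, ρ a = g) ∨ (∃ a, τ a = g))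
    (h : TripleProductProperty S T U)
    (hS : (univ.filter fun a => ρ a ∈ S).card = (univ.filter fun a => τ a ∈ S).card)
    (hT : (univ.filter fun a => ρ a ∈ T).card = (univ.filter fun a => τ a ∈ T).card)
    (hU : (univ.filter fun a => ρ a ∈ U).card = (univ.filter fun a => τ a ∈ U).card)
    (h44 : ((univ.filter fun a => ρ a ∈ S).card = 4 ∧ (univ.filter fun a => ρ a ∈ T).card = 4) ∨
      ((univ.filter fun a => ρ a ∈ T).card = 4 ∧ (univ.filter fun a => ρ a ∈ U).card = 4) ∨
      ((univ.filter fun a => ρ a ∈ U).card = 4 ∧ (univ.filter fun a => ρ a ∈ S).card = 4) ∨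
      ((univ.filter fun a => ρ a ∈ S).card = 4 ∧ (univ.filter fun a => ρ a ∈ T).card = 4) ∨
      ((univ.filter fun a => ρ a ∈ T).card = 4 ∧ (univ.filter fun a => ρ a ∈ U).card = 4) ∨
      ((univ.filter fun a => ρ a ∈ U).card = 4 ∧ (univ.filter fun a => ρ a ∈ S).card = 4)) :
    3 * (S.card * T.card * U.card) + 8 ≠ 8 * Fintype.card (ZMod 5 × ZMod 5 × ZMod 25) :=
  no_law_cube_four_four_of_onto_z5z5_card625 (by simp [Fintype.card_prod, ZMod.card]) hρρ hρτ hτρ hττ hρ hτ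
    hne hsurj projZ5Z5Z25 projZ5Z5Z25_surjective h hS hT hU h44

/-- **Census instance `(4,4,13)@625` for `A = ℤ₅⁴`** (any `c₀`). [folklore] -/
theorem no_law_cube_four_four_z5_pow4 {ρ τ : ZMod 5 × ZMod 5 × ZMod 5 × ZMod 5 → G} {c₀ : ZMod 5 × ZMod 5 × ZMod 5 × ZMod 5}
    (hρρ : ∀ a b, ρ a * ρ b = ρ (a + b)) (hρτ : ∀ a b, ρ a * τ b = τ (b - a))
    (hτρ : ∀ a b, τ a * ρ b = τ (a + b)) (hττ : ∀ a b, τ a * τ b = ρ (c₀ + b - a))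
    (hρ : Function.Injective ρ) (hτ : Function.Injective τ) (hne : ∀ a b, ρ a ≠ τ b)
    (hsurj : ∀ g, (∃ a, ρ a = g) ∨ (∃ a, τ a = g))
    (h : TripleProductProperty S T U)
    (hS : (univ.filter fun a => ρ a ∈ S).card = (univ.filter fun a => τ a ∈ S).card)
    (hT : (univ.filter fun a => ρ a ∈ T).card = (univ.filter fun a => τ a ∈ T).card)
    (hU : (univ.filter fun a => ρ a ∈ U).card = (univ.filter fun a => τ a ∈ U).card)
    (h44 : ((univ.filter fun a => ρ a ∈ S).card = 4 ∧ (univ.filter fun a => ρ a ∈ T).card = 4) ∨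
      ((univ.filter fun a => ρ a ∈ T).card = 4 ∧ (univ.filter fun a => ρ a ∈ U).card = 4) ∨
      ((univ.filter fun a => ρ a ∈ U).card = 4 ∧ (univ.filter fun a => ρ a ∈ S).card = 4) ∨
      ((univ.filter fun a => ρ a ∈ S).card = 4 ∧ (univ.filter fun a => ρ a ∈ T).card = 4) ∨
      ((univ.filter fun a => ρ a ∈ T).card = 4 ∧ (univ.filter fun a => ρ a ∈ U).card = 4) ∨
      ((univ.filter fun a => ρ a ∈ U).card = 4 ∧ (univ.filter fun a => ρ a ∈ S).card = 4)) :
    3 * (S.card * T.card * U.card) + 8 ≠ 8 * Fintype.card (ZMod 5 × ZMod 5 × ZMod 5 × ZMod 5) :=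
  no_law_cube_four_four_of_onto_z5z5_card625 (by simp [Fintype.card_prod, ZMod.card]) hρρ hρτ hτρ hττ hρ hτ
    hne hsurj projZ5Pow4 projZ5Pow4_surjective h hS hT hU h44

end DihedralLike

end Summit.MatrixMultiplication.OmegaCensus
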